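import Mathlib.MeasureTheory.Integral.DivergenceTheorem
import Mathlib.MeasureTheory.Measure.Haar.InnerProductSpace
import Literature.Analysis.FluidPDE.BiotSavartCurlPair
import HarnessLib

/-!
# Gauss–Green for differentiable compactly supported fields, and the distributional curl of a
# differentiable field

Analysis/FluidPDE **proofs file** (theorems only: no definitions, no named facts, no `sorry`),
first of two files serving the named facts `Literature.Analysis.FluidPDE.LeiZhang2011_liouville`
and `Literature.Analysis.FluidPDE.LeiZhang2011_regularity_bmoStream` (`LeiZhang2011.lean`;
Z. Lei, Q. S. Zhang, J. Funct. Anal. 261 (2011) = arXiv:1011.5066, Thms. 1.2 and 1.4), whose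
stream functions (`HasBMOStreamFunctionOn`) have *differentiable* slices with `curl (B t) = u t`
almost everywhere — no integrability of `DB` is part of the hypothesis. To use such a `B` as a
stream function in the sense of distributions one needs:

* `integral_sum_fderiv_apply_eq_zero_of_differentiable`,
  `integral_divergence_eq_zero_of_differentiable` — **Gauss–Green on the whole space for
  differentiable compactly supported fields whose divergence is integrable** (no integrability of
  the full derivative): Mathlib's Henstock–Kurzweil-type divergence theorem on boxes
  (`MeasureTheory.integral_divergence_of_hasFDerivAt_off_countable`) on a box containing the
  support, transported to `EuclideanSpace ℝ (Fin (n+1))` by the volume-preserving `toLp` (the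
  plumbing of `BoxTransportConservation.integral_unitCube_divergence_eq_zero_of_tangent`); the
  tree's `integral_divergence_eq_zero` (`WholeSpaceIBP`) asks `C¹`.
* `integral_mul_inner_eq_integral_inner_cross_gradient` — **the distributional curl of a
  differentiable field**: if `B : ℝ³ → ℝ³` is differentiable everywhere and `curl B = w` a.e.
  with `w` locally integrable, then `∫ φ ⟪w, e⟫ = ∫ ⟪B × ∇φ, e⟫` for all `φ ∈ C¹_c(ℝ³)`,
  `e ∈ ℝ³`
  (Gauss–Green for the differentiable field `B × (φ e)`, whose divergence
  `φ ⟪e, curl B⟫ - ⟪B × ∇φ, e⟫` is integrable). The `C¹` version is the tree's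
  `integral_inner_curl_eq_integral_inner_curl` (`VorticityCalculus`).
* the triple-product identities `inner_cross_right_eq_inner_cross_left`, `inner_cross_left_swap`.

## Mathlib / tree search

Reused: `integral_divergence_of_hasFDerivAt_off_countable`, `PiLp.volume_preserving_toLp`,
`HasCompactSupport.exists_pos_le_norm`, `PiLp.norm_apply_le`,
`LocallyIntegrable.integrable_smul_left_of_hasCompactSupport` (Mathlib);
`divergence_eq_sum_inner_fderiv`, `divergence_cross_holds`, `hasFDerivAt_cross`, `crossCLM`
(`VectorCalculus`), `curl_smul_const` (`BiotSavartCurlPair`), `continuous_gradient_of_contDiff`,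
`gradient_eq_zero_of_notMem_tsupport` (`WholeSpaceIBP`). `lean search 'off_countable'` in
`Literature/`: only period boxes (`Calculus/PeriodicDivergence`), cubes with tangency
(`BoxTransportConservation`) and periodic cylinders (`PeriodicCylinder*`); no whole-space version
under mere differentiability, and no distributional-curl statement for differentiable fields.

## References

* Z. Lei, Q. S. Zhang, *A Liouville theorem for the axially-symmetric Navier–Stokes equations*,
  J. Funct. Anal. 261 (2011) 2323–2345 = arXiv:1011.5066, §1 ("a function `B` is called a stream
  function of `v` if `v = ∇ × B`"), §4. [LeiZhang2011]
* L. C. Evans, *Partial Differential Equations*, 2nd ed. (2010), App. C.2 (Gauss–Green).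
  [Evans2010]
-/

noncomputable section

open MeasureTheory Set Function Filter Topology TopologicalSpace Metric
open scoped InnerProductSpace RealInnerProductSpace NNReal ENNReal Laplacian

namespace Literature.Analysis.FluidPDE

open Literature.Analysis.FunctionSpaces

section DivergenceTheorem

variable {n : ℕ}

/-- **Gauss–Green on the whole space for differentiable compactly supported fields.** If
`G : ℝ^{n+1} → ℝ^{n+1}` is differentiable everywhere, compactly supported, and its divergence
`Σⱼ ∂ⱼGⱼ` is integrable, then `∫ div G = 0`. Only integrability of the divergence (not of
the full derivative) is needed: this is Mathlib's divergence theorem on boxes for the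
Henstock–Kurzweil type integral
(`MeasureTheory.integral_divergence_of_hasFDerivAt_off_countable`), applied on a box containing
the support and transported to `EuclideanSpace` by the volume-preserving `toLp`.
[folklore] -/
theorem integral_sum_fderiv_apply_eq_zero_of_differentiable
    {G : EuclideanSpace ℝ (Fin (n + 1)) → EuclideanSpace ℝ (Fin (n + 1))}
    (hG : Differentiable ℝ G) (hGc : HasCompactSupport G)
    (hi : Integrable (fun z => ∑ j, fderiv ℝ G z (EuclideanSpace.single j 1) j)) :
    ∫ z, ∑ j, fderiv ℝ G z (EuclideanSpace.single j 1) j = 0 := by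
  obtain ⟨R, hR, hGR⟩ := hGc.exists_pos_le_norm
  set eqv : EuclideanSpace ℝ (Fin (n + 1)) ≃L[ℝ] (Fin (n + 1) → ℝ) :=
    EuclideanSpace.equiv (Fin (n + 1)) ℝ with heqv
  set f : (Fin (n + 1) → ℝ) → (Fin (n + 1) → ℝ) := fun x => eqv (G (eqv.symm x)) with hf
  set f' : (Fin (n + 1) → ℝ) → (Fin (n + 1) → ℝ) →L[ℝ] (Fin (n + 1) → ℝ) :=
    fun x =>
    ((eqv : EuclideanSpace ℝ (Fin (n + 1)) →L[ℝ] (Fin (n + 1) → ℝ)).comp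
      (fderiv ℝ G (eqv.symm x))).comp
      (eqv.symm : (Fin (n + 1) → ℝ) →L[ℝ] EuclideanSpace ℝ (Fin (n + 1))) with hf'
  have hderiv : ∀ x, HasFDerivAt f (f' x) x := fun x =>
    (eqv.hasFDerivAt.comp _ (hG (eqv.symm x)).hasFDerivAt).comp x eqv.symm.hasFDerivAt
  have hcontf : Continuous f := eqv.continuous.comp (hG.continuous.comp eqv.symm.continuous)
  -- the divergence in coordinates is the divergence
  set F : EuclideanSpace ℝ (Fin (n + 1)) → ℝ := fun z =>
    ∑ j, fderiv ℝ G z (EuclideanSpace.single j 1) j with hF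
  have hdiv_eq : ∀ x, ∑ i, f' x (Pi.single i 1) i = F (WithLp.toLp 2 x) := by
    intro x
    refine Finset.sum_congr rfl fun i _ => ?_
    simp only [hf', ContinuousLinearMap.comp_apply, ContinuousLinearEquiv.coe_coe]
    rfl
  -- `G` and its derivative vanish where `‖z‖ ≥ R`
  have hGzero : ∀ z : EuclideanSpace ℝ (Fin (n + 1)), R ≤ ‖z‖ → G z = 0 := hGR
  have hFzero : ∀ z : EuclideanSpace ℝ (Fin (n + 1)), R < ‖z‖ → F z = 0 := by
    intro z hz
    have hev : G =ᶠ[𝓝 z] fun _ => 0 := by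
      have ho : IsOpen {y : EuclideanSpace ℝ (Fin (n + 1)) | R < ‖y‖} :=
        isOpen_lt continuous_const continuous_norm
      filter_upwards [ho.mem_nhds hz] with y hy
      exact hGzero y (le_of_lt hy)
    have hfd : fderiv ℝ G z = 0 := by
      rw [hev.fderiv_eq]; simp
    simp [hF, hfd]
  -- the box `[-(R+1), R+1]^{n+1}`
  set a : Fin (n + 1) → ℝ := fun _ => -(R + 1) with ha
  set b : Fin (n + 1) → ℝ := fun _ => R + 1 with hb
  have hab : a ≤ b := fun _ => by simp only [ha, hb]; linarith
  -- coordinates dominate: `|z i| ≤ ‖z‖`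
  have hcoord : ∀ (z : EuclideanSpace ℝ (Fin (n + 1))) (i : Fin (n + 1)), |z i| ≤ ‖z‖ :=
    fun z i => by simpa [Real.norm_eq_abs] using PiLp.norm_apply_le z i
  have hDT := integral_divergence_of_hasFDerivAt_off_countable a b hab f f' ∅ countable_empty
    hcontf.continuousOn (fun x _ => hderiv x)
    (by
      simp_rw [hdiv_eq]
      exact ((PiLp.volume_preserving_toLp (Fin (n + 1))).integrable_comp_emb
        (MeasurableEquiv.toLp 2 (Fin (n + 1) → ℝ)).measurableEmbedding |>.2 hi).integrableOn)
  -- every face term vanishes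
  have hfaces : ∀ i : Fin (n + 1), ∀ c : ℝ, R + 1 ≤ |c| →
      ∀ x : Fin n → ℝ, f (Fin.insertNth i c x) i = 0 := by
    intro i c hc x
    have hz : R ≤ ‖(WithLp.toLp 2 (Fin.insertNth i c x : Fin (n + 1) → ℝ) :
        EuclideanSpace ℝ (Fin (n + 1)))‖ := by
      refine le_trans ?_ (hcoord _ i)
      show R ≤ |(Fin.insertNth i c x : Fin (n + 1) → ℝ) i|
      rw [Fin.insertNth_apply_same]
      linarith
    have : G (eqv.symm (Fin.insertNth i c x)) = 0 := hGzero _ hz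
    simp [hf, this]
  have hRHS : (∑ i : Fin (n + 1),
      ((∫ x in Icc (a ∘ Fin.succAbove i) (b ∘ Fin.succAbove i),
          f (Fin.insertNth i (b i) x) i) -
        ∫ x in Icc (a ∘ Fin.succAbove i) (b ∘ Fin.succAbove i),
          f (Fin.insertNth i (a i) x) i)) = 0 := by
    refine Finset.sum_eq_zero fun i _ => ?_
    have h1 : ∀ x : Fin n → ℝ, f (Fin.insertNth i (b i) x) i = 0 := fun x =>
      hfaces i (b i) (by simp only [hb]; rw [abs_of_pos (by linarith)]) x
    have h2 : ∀ x : Fin n → ℝ, f (Fin.insertNth i (a i) x) i = 0 := fun x =>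
      hfaces i (a i) (by simp only [ha]; rw [abs_neg, abs_of_pos (by linarith)]) x
    simp_rw [h1, h2]
    simp
  rw [hRHS] at hDT
  simp_rw [hdiv_eq] at hDT
  -- the box integral is the whole-space integral in coordinates
  have hbox : (∫ x in Icc a b, F (WithLp.toLp 2 x)) = ∫ x, F (WithLp.toLp 2 x) := by
    refine setIntegral_eq_integral_of_forall_compl_eq_zero fun x hx => hFzero _ ?_
    -- some coordinate lies outside `[-(R+1), R+1]`
    simp only [mem_Icc, Pi.le_def, ha, hb, not_and_or, not_forall, not_le] at hx
    rcases hx with ⟨i, hi⟩ | ⟨i, hi⟩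
    · have h1 : R + 1 < |x i| := by
        rw [abs_of_neg (by linarith)]; linarith
      exact lt_of_lt_of_le (by linarith) (le_trans h1.le (hcoord (WithLp.toLp 2 x) i))
    · have h1 : R + 1 < |x i| := by
        rw [abs_of_pos (by linarith)]; linarith
      exact lt_of_lt_of_le (by linarith) (le_trans h1.le (hcoord (WithLp.toLp 2 x) i))
  rw [hbox] at hDT
  -- transport to `EuclideanSpace`
  have key := (PiLp.volume_preserving_toLp (Fin (n + 1))).integral_comp
    (MeasurableEquiv.toLp 2 (Fin (n + 1) → ℝ)).measurableEmbedding F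
  rw [← key]
  exact hDT

/-- The coordinate divergence `Σⱼ ∂ⱼGⱼ` is the tree's (trace) divergence. [folklore] -/
theorem sum_fderiv_apply_single_eq_divergence
    (G : EuclideanSpace ℝ (Fin (n + 1)) → EuclideanSpace ℝ (Fin (n + 1)))
    (z : EuclideanSpace ℝ (Fin (n + 1))) :
    ∑ j, fderiv ℝ G z (EuclideanSpace.single j 1) j = VectorCalculus.divergence G z := by
  rw [divergence_eq_sum_inner_fderiv (EuclideanSpace.basisFun (Fin (n + 1)) ℝ)]
  refine Finset.sum_congr rfl fun j _ => ?_
  rw [EuclideanSpace.basisFun_apply, EuclideanSpace.inner_single_left]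
  simp

/-- **`∫ div G = 0`** for a differentiable, compactly supported field on `ℝ^{n+1}` with
integrable divergence (trace form of `integral_sum_fderiv_apply_eq_zero_of_differentiable`).
[folklore] -/
theorem integral_divergence_eq_zero_of_differentiable
    {G : EuclideanSpace ℝ (Fin (n + 1)) → EuclideanSpace ℝ (Fin (n + 1))}
    (hG : Differentiable ℝ G) (hGc : HasCompactSupport G)
    (hi : Integrable (VectorCalculus.divergence G)) :
    ∫ z, VectorCalculus.divergence G z = 0 := by
  have h := integral_sum_fderiv_apply_eq_zero_of_differentiable hG hGc
    (by simpa only [sum_fderiv_apply_single_eq_divergence] using hi)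
  simpa only [sum_fderiv_apply_single_eq_divergence] using h

end DivergenceTheorem

/-- The scalar triple product is cyclic: `⟪a, g × e⟫ = ⟪a × g, e⟫`. [folklore] -/
theorem inner_cross_right_eq_inner_cross_left (a g e : EuclideanSpace ℝ (Fin 3)) :
    ⟪a, cross g e⟫ = ⟪cross a g, e⟫ := by
  simp only [cross, PiLp.inner_apply, RCLike.inner_apply, conj_trivial, Fin.sum_univ_three,
    cross_apply, Matrix.cons_val_zero, Matrix.cons_val_one, Matrix.cons_val_two,
    Matrix.head_cons, Matrix.tail_cons]
  ring

/-- `⟪a × g, e⟫ = -⟪a × e, g⟫` (the triple product is alternating). [folklore] -/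
theorem inner_cross_left_swap (a g e : EuclideanSpace ℝ (Fin 3)) :
    ⟪cross a g, e⟫ = -⟪cross a e, g⟫ := by
  simp only [cross, PiLp.inner_apply, RCLike.inner_apply, conj_trivial, Fin.sum_univ_three,
    cross_apply, Matrix.cons_val_zero, Matrix.cons_val_one, Matrix.cons_val_two,
    Matrix.head_cons, Matrix.tail_cons]
  ring

/-- **The distributional curl of a differentiable field.** Let `B : ℝ³ → ℝ³` be
differentiable everywhere with `curl B = w` almost everywhere for a locally integrable `w` (no
integrability is asked of the full derivative `DB`). Then `curl B = w` in `𝓓'`: for every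
`φ ∈ C¹_c(ℝ³)` and `e ∈ ℝ³`, `∫ φ ⟪w, e⟫ = ∫ ⟪B × ∇φ, e⟫`. Proof: the field `B × (φ e)` is
differentiable, compactly supported, with divergence `φ ⟪e, curl B⟫ - ⟪B, ∇φ × e⟫`
(`divergence_cross_holds`, `curl_smul_const`), which is integrable, so Gauss–Green for
differentiable fields
(`integral_divergence_eq_zero_of_differentiable`, only the divergence integrable) applies.
[folklore] -/
theorem integral_mul_inner_eq_integral_inner_cross_gradient
    {B w : EuclideanSpace ℝ (Fin 3) → EuclideanSpace ℝ (Fin 3)}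
    (hB : Differentiable ℝ B) (hcurl : curl B =ᵐ[volume] w) (hw : LocallyIntegrable w volume)
    {φ : EuclideanSpace ℝ (Fin 3) → ℝ} (hφ : ContDiff ℝ 1 φ) (hφc : HasCompactSupport φ)
    (e : EuclideanSpace ℝ (Fin 3)) :
    ∫ x, φ x * ⟪w x, e⟫ = ∫ x, ⟪cross (B x) (gradient φ x), e⟫ := by
  -- the field `W = B × (φ e)`
  have hφd : Differentiable ℝ φ := hφ.differentiable one_ne_zero
  have hφe : Differentiable ℝ fun y => φ y • e := hφd.smul_const e
  set W : EuclideanSpace ℝ (Fin 3) → EuclideanSpace ℝ (Fin 3) :=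
    fun y => cross (B y) (φ y • e) with hW
  have hWd : Differentiable ℝ W := fun y =>
    (hasFDerivAt_cross (hB y).hasFDerivAt (hφe y).hasFDerivAt).differentiableAt
  have hWc : HasCompactSupport W := by
    refine hφc.mono fun x hx => ?_
    contrapose! hx
    simp only [mem_support, not_not] at hx
    simp [hW, hx, ← crossCLM_apply]
  -- its divergence, pointwise
  have hdiv : ∀ x, VectorCalculus.divergence W x =
      φ x * ⟪e, curl B x⟫ - ⟪cross (B x) (gradient φ x), e⟫ := by
    intro x
    rw [hW, divergence_cross_holds B (fun y => φ y • e) x (hB x) (hφe x),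
      curl_smul_const (hφd x) e, real_inner_smul_left, inner_cross_right_eq_inner_cross_left]
  -- integrability of the divergence (it is a.e. `φ ⟪e, w⟫ - ⟪B × ∇φ, e⟫`)
  have hgradc : Continuous (gradient φ) := continuous_gradient_of_contDiff hφ
  have h2c : Continuous fun x => ⟪cross (B x) (gradient φ x), e⟫ :=
    ((crossCLM.continuous₂.comp₂ hB.continuous hgradc).inner continuous_const)
  have h2s : HasCompactSupport fun x => ⟪cross (B x) (gradient φ x), e⟫ := by
    refine hφc.mono' fun x hx => ?_
    contrapose! hx
    simp only [mem_support, not_not]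
    rw [gradient_eq_zero_of_notMem_tsupport hx, ← crossCLM_apply, map_zero, inner_zero_left]
  have h2i : Integrable (fun x => ⟪cross (B x) (gradient φ x), e⟫) :=
    h2c.integrable_of_hasCompactSupport h2s
  have h1i : Integrable (fun x => φ x * ⟪e, w x⟫) := by
    have := (hw.integrable_smul_left_of_hasCompactSupport hφ.continuous hφc).const_inner
      (𝕜 := ℝ) e
    refine this.congr (Eventually.of_forall fun x => ?_)
    simp only [real_inner_smul_right]
  have h1i' : Integrable (fun x => φ x * ⟪e, curl B x⟫) := by
    refine h1i.congr ?_
    filter_upwards [hcurl] with x hx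
    rw [hx]
  have hdi : Integrable (VectorCalculus.divergence W) := by
    have : VectorCalculus.divergence W =
        fun x => φ x * ⟪e, curl B x⟫ - ⟪cross (B x) (gradient φ x), e⟫ := funext hdiv
    rw [this]
    exact h1i'.sub h2i
  have h0 := integral_divergence_eq_zero_of_differentiable hWd hWc hdi
  simp_rw [hdiv] at h0
  rw [integral_sub h1i' h2i, sub_eq_zero] at h0
  rw [← h0]
  refine integral_congr_ae ?_
  filter_upwards [hcurl] with x hx
  rw [hx, real_inner_comm]

end Literature.Analysis.FluidPDE
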